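import Literature.NumberTheory.LFunctions.ConreyIwaniec2002AFEDefs
import Literature.NumberTheory.LFunctions.HuxleyLargeValuesFourthMomentProofs
import Literature.NumberTheory.NumberFields.ClassNumberRegulatorUpperBound
import Literature.Analysis.SpecialFunctions.GammaStirlingVertical
import Mathlib.Analysis.Complex.Liouville
import Mathlib.Analysis.SpecialFunctions.Gamma.Deriv
import HarnessLib

/-!
# Conrey–Iwaniec (2002), §8: the residual term of the approximate functional equation is harmless

B. Conrey, H. Iwaniec, *Spacing of zeros of Hecke L-functions and the class number problem*,
Acta Arith. 103 (2002), Proposition 7.1 (7.12) and §8 (8.4)–(8.10) [held text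
`paper:arxiv-math_0111012`, p0017–p0018].

For the trivial class group character the approximate functional equation (7.12) carries the
residual term (corrected, both poles) `R(w) = −κ_K Q^{1−w} Γ(w)^{−1}(G(1−w)/(1−w) + G(w)/w)`,
`G(u) = e^{u²}` (the tree's `afeR`; `0` for `ψ ≠ 1`). On `|Re z − ½| ≤ ¼`, `|Im z| = y`:
`|G(z)|, |G(1−z)| ≤ e^{1−y²}`, `|Γ(z)|^{−1} ≪ y^{1/4}e^{πy/2}` (Stirling, the tree's
`GammaStirling.exists_norm_Gamma_vertical_ge`), `κ_K ≤ q e⁴(7/2)³`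
(`dedekindZeta_residue_le_abs_discr`), `Q^{1−x} ≤ q + 1`; so `|R(z)| ≪ q(q+1)e^{3y − y²} ≪ 1` once
`y ≥ q + 1`, `y ≥ 4`. By Cauchy's estimate on discs of radius `¼` and the mean value theorem along
the critical line, the divided differences `r(s) = (R(s) − R(s′))/(s − s′)` (`|s − s′| ≤ 1`, height
`≍ T ≥ q^66`) are bounded, and `Σ_{s ∈ S} |r(s)|² ≪ #S ≪ T` (`ZetaM4D.card_le_of_sep`). This is the
registered stub S6a `stub_residual_meanSquare` of the line `prop81-afe-plancherel`
(`residual_meanSquare_le`). Everything PROVED; no definition.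

«The programme SEARCHES and TYPES; no claim about Landau–Siegel zeros until a kernel theorem says so.»

## References
* [ConreyIwaniec2002] B. Conrey, H. Iwaniec, Acta Arith. 103 (2002) 259–312, arXiv:math/0111012:
  Proposition 7.1 (7.12); §8 (8.4)–(8.10).
-/

noncomputable section

open scoped NumberField
open Complex

namespace Literature.NumberTheory.LFunctions

namespace ConreyIwaniec2002

open NumberField Literature.Analysis.SpecialFunctions

/-! ## §1. The residual as an explicit holomorphic function -/

/-- For `ψ = 1` the residual is the explicit function
`R(w) = −κ_K Q^{1−w}/Γ(w)·(G(1−w)/(1−w) + G(w)/w)`. [cite: ConreyIwaniec2002, Proposition 7.1 (7.12)] -/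
theorem afeR_one (K : Type) [Field K] [NumberField K] (q : ℕ) (s : ℂ) :
    afeR K 1 q s = -(NumberField.dedekindZeta_residue K : ℂ) * (condQ q : ℂ) ^ (1 - s) /
      Complex.Gamma s * (afeG (1 - s) / (1 - s) + afeG s / s) := by
  simp [afeR]

/-- `R` is complex-differentiable off the real axis (`Γ(z) ≠ 0`, `z ≠ 0, 1` there).
[cite: ConreyIwaniec2002, Proposition 7.1 (7.12)] -/
theorem differentiableAt_afeR_one (K : Type) [Field K] [NumberField K] {q : ℕ} (hq : 0 < q)
    {z : ℂ} (hz : z.im ≠ 0) : DifferentiableAt ℂ (afeR K 1 q) z := by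
  have hfun : afeR K 1 q = fun s => -(NumberField.dedekindZeta_residue K : ℂ) * (condQ q : ℂ) ^ (1 - s) /
      Complex.Gamma s * (afeG (1 - s) / (1 - s) + afeG s / s) := by
    funext s; exact afeR_one K q s
  rw [hfun]
  have hQ : (condQ q : ℂ) ≠ 0 := by exact_mod_cast (condQ_pos hq).ne'
  have hz0 : z ≠ 0 := fun h => hz (by rw [h]; simp)
  have hz1 : 1 - z ≠ 0 := by
    intro h; apply hz
    have := congrArg Complex.im h; simpa using this
  have hΓne : ∀ m : ℕ, z ≠ -m := fun m h => hz (by rw [h]; simp)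
  have hΓ : Complex.Gamma z ≠ 0 := Complex.Gamma_ne_zero hΓne
  have h1 : DifferentiableAt ℂ (fun s : ℂ => (condQ q : ℂ) ^ (1 - s)) z :=
    ((differentiableAt_const _).sub differentiableAt_id).const_cpow (Or.inl hQ)
  have h2 : DifferentiableAt ℂ Complex.Gamma z := Complex.differentiableAt_Gamma z hΓne
  have h3 : DifferentiableAt ℂ (fun s : ℂ => afeG (1 - s) / (1 - s)) z :=
    ((differentiable_afeG.differentiableAt).comp z ((differentiableAt_const _).sub differentiableAt_id)).div
      ((differentiableAt_const _).sub differentiableAt_id) hz1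
  have h4 : DifferentiableAt ℂ (fun s : ℂ => afeG s / s) z :=
    (differentiable_afeG.differentiableAt).div differentiableAt_id hz0
  exact (((differentiableAt_const _).mul h1).div h2 hΓ).mul (h3.add h4)

/-! ## §2. The uniform bound for `R` near the critical line -/

/-- `x² e^{−x} ≤ 2` for `x ≥ 0`. [cite: ConreyIwaniec2002, §8 (8.10)] -/
theorem sq_mul_exp_neg_le_two {x : ℝ} (hx : 0 ≤ x) : x ^ 2 * Real.exp (-x) ≤ 2 := by
  have h := Real.quadratic_le_exp_of_nonneg hx
  rw [Real.exp_neg, ← div_eq_mul_inv, div_le_iff₀ (Real.exp_pos x)]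
  nlinarith

/-- **Uniform bound for the residual near the critical line**: there is an absolute `M` with
`|R(z)| ≤ M` for `|Re z − ½| ≤ ¼`, `|Im z| ≥ max(q + 1, 4)` (`K = ℚ(√−q)`, `[K:ℚ] = 2`,
`d_K = −q`). [cite: ConreyIwaniec2002, §8 (8.10), Proposition 7.1 (7.12)] -/
theorem norm_afeR_one_le :
    ∃ M : ℝ, 0 < M ∧ ∀ (q : ℕ), 0 < q → ∀ (K : Type) [Field K] [NumberField K],
      Module.finrank ℚ K = 2 → NumberField.discr K = -(q : ℤ) →
        ∀ z : ℂ, 1 / 4 ≤ z.re → z.re ≤ 3 / 4 → (q : ℝ) + 1 ≤ |z.im| → 4 ≤ |z.im| →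
          ‖afeR K 1 q z‖ ≤ M := by
  obtain ⟨c, hc, hΓ⟩ := GammaStirling.exists_norm_Gamma_vertical_ge (1 / 4 : ℝ) (3 / 4)
  -- constant: `κ ≤ q·κ₀` with `κ₀ = e⁴(7/2)³`; `M = 2·2·e·κ₀/c`
  set κ₀ : ℝ := Real.exp (2 * 2) * (7 / 2 : ℝ) ^ (2 + 1) with hκ₀
  have hκ₀0 : 0 < κ₀ := by positivity
  refine ⟨4 * Real.exp 1 * κ₀ / c, by positivity, ?_⟩
  intro q hq K _ _ h2 hdisc z hre1 hre2 hyq hy4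
  have hq1 : (1 : ℝ) ≤ q := by exact_mod_cast hq
  have hQ : 0 < condQ q := condQ_pos hq
  set x : ℝ := z.re with hx
  set y : ℝ := z.im with hy
  have hz : z = (x : ℂ) + y * I := (Complex.re_add_im z).symm
  have hy1 : 1 ≤ |y| := by linarith
  have hy0 : 0 < |y| := by linarith
  -- `κ ≤ q κ₀`
  have hκ : NumberField.dedekindZeta_residue K ≤ q * κ₀ := by
    have h := Literature.NumberTheory.NumberFields.dedekindZeta_residue_le_abs_discr K
    rw [h2, hdisc] at h
    have habs : |(((-(q : ℤ)) : ℤ) : ℝ)| = q := by push_cast; rw [abs_neg]; exact abs_of_nonneg (by positivity)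
    rw [habs] at h
    calc NumberField.dedekindZeta_residue K ≤ q * Real.exp (2 * (2 : ℕ)) * (7 / 2 : ℝ) ^ ((2 : ℕ) + 1) := h
      _ = q * κ₀ := by rw [hκ₀]; push_cast; ring
  have hκpos : 0 < NumberField.dedekindZeta_residue K := NumberField.dedekindZeta_residue_pos K
  -- `‖Q^{1−z}‖ ≤ q + 1`
  have hQpow : ‖(condQ q : ℂ) ^ (1 - z)‖ ≤ q + 1 := by
    rw [Complex.norm_cpow_eq_rpow_re_of_pos hQ]
    have hre : (1 - z).re = 1 - x := by simp [hx]
    rw [hre]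
    have hQle : condQ q ≤ q := by
      unfold condQ
      rw [div_le_iff₀ (by positivity)]
      have hs : Real.sqrt q ≤ q := by rw [Real.sqrt_le_left (by positivity)]; nlinarith
      nlinarith [Real.pi_gt_three, Real.sqrt_nonneg (q : ℝ)]
    rcases le_or_gt 1 (condQ q) with h1 | h1
    · calc condQ q ^ (1 - x) ≤ condQ q ^ (1 : ℝ) :=
            Real.rpow_le_rpow_of_exponent_le h1 (by linarith)
        _ ≤ q + 1 := by rw [Real.rpow_one]; linarith
    · calc condQ q ^ (1 - x) ≤ 1 := Real.rpow_le_one hQ.le h1.le (by linarith)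
        _ ≤ q + 1 := by linarith
  -- `‖Γ(z)‖⁻¹ ≤ c⁻¹ |y| e^{π|y|/2}`
  have hΓz : c * (|y| ^ (x - 1 / 2) * Real.exp (-(Real.pi * |y|) / 2)) ≤ ‖Complex.Gamma z‖ := by
    have h := hΓ x ⟨hre1, hre2⟩ y hy1
    rw [hz]; linarith [h]
  have hypow : |y| ^ (-(1 : ℝ)) ≤ |y| ^ (x - 1 / 2) :=
    Real.rpow_le_rpow_of_exponent_le hy1 (by linarith)
  have hΓpos : 0 < ‖Complex.Gamma z‖ := by
    have : 0 < c * (|y| ^ (x - 1 / 2) * Real.exp (-(Real.pi * |y|) / 2)) := by positivity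
    linarith
  have hΓinv : ‖Complex.Gamma z‖⁻¹ ≤ c⁻¹ * (|y| * Real.exp (Real.pi * |y| / 2)) := by
    rw [inv_le_comm₀ hΓpos (by positivity)]
    have e : (c⁻¹ * (|y| * Real.exp (Real.pi * |y| / 2)))⁻¹ =
        c * (|y| ^ (-(1 : ℝ)) * Real.exp (-(Real.pi * |y|) / 2)) := by
      rw [Real.rpow_neg_one, mul_inv, inv_inv, mul_inv, ← Real.exp_neg]
      ring_nf
    rw [e]
    exact le_trans (mul_le_mul_of_nonneg_left
      (mul_le_mul_of_nonneg_right hypow (Real.exp_pos _).le) hc.le) hΓz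
  -- `‖G(z)‖, ‖G(1−z)‖ ≤ e^{1−y²}`
  have hG1 : ‖afeG z‖ ≤ Real.exp (1 - y ^ 2) := by
    rw [hz, norm_afeG]
    apply Real.exp_le_exp.mpr
    nlinarith
  have hG2 : ‖afeG (1 - z)‖ ≤ Real.exp (1 - y ^ 2) := by
    have : (1 : ℂ) - z = ((1 - x : ℝ) : ℂ) + (-y : ℝ) * I := by rw [hz]; push_cast; ring
    rw [this, norm_afeG]
    apply Real.exp_le_exp.mpr
    nlinarith
  have hzn : |y| ≤ ‖z‖ := by rw [hy]; exact Complex.abs_im_le_norm z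
  have h1zn : |y| ≤ ‖1 - z‖ := by
    have := Complex.abs_im_le_norm (1 - z)
    simp at this
    rw [hy]; exact this
  have hsum : ‖afeG (1 - z) / (1 - z) + afeG z / z‖ ≤ 2 * Real.exp (1 - y ^ 2) := by
    calc ‖afeG (1 - z) / (1 - z) + afeG z / z‖ ≤ ‖afeG (1 - z) / (1 - z)‖ + ‖afeG z / z‖ := norm_add_le _ _
      _ = ‖afeG (1 - z)‖ / ‖1 - z‖ + ‖afeG z‖ / ‖z‖ := by rw [norm_div, norm_div]
      _ ≤ Real.exp (1 - y ^ 2) / 1 + Real.exp (1 - y ^ 2) / 1 := by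
          gcongr
          · linarith
          · linarith
      _ = 2 * Real.exp (1 - y ^ 2) := by ring
  -- assemble
  rw [afeR_one, norm_mul, norm_div, norm_mul, norm_neg, Complex.norm_real, Real.norm_eq_abs,
    abs_of_pos hκpos]
  have hexp : |y| * Real.exp (Real.pi * |y| / 2) * Real.exp (1 - y ^ 2) ≤
      Real.exp 1 * Real.exp (-|y|) := by
    have hyy : y ^ 2 = |y| ^ 2 := (sq_abs y).symm
    have h1 : |y| ≤ Real.exp |y| := by linarith [Real.add_one_le_exp |y|]
    have hpi : Real.pi * |y| / 2 ≤ 2 * |y| := by nlinarith [Real.pi_le_four]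
    calc |y| * Real.exp (Real.pi * |y| / 2) * Real.exp (1 - y ^ 2)
        ≤ Real.exp |y| * Real.exp (2 * |y|) * Real.exp (1 - y ^ 2) := by
          gcongr
      _ = Real.exp 1 * Real.exp (3 * |y| - |y| ^ 2) := by
          rw [← Real.exp_add, ← Real.exp_add, ← Real.exp_add, hyy]; ring_nf
      _ ≤ Real.exp 1 * Real.exp (-|y|) := by
          gcongr
          nlinarith
  have hqq : (q : ℝ) * (q + 1) * Real.exp (-|y|) ≤ 2 := by
    have h1 : Real.exp (-|y|) ≤ Real.exp (-(q + 1 : ℝ)) := Real.exp_le_exp.mpr (by linarith)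
    have h2 := sq_mul_exp_neg_le_two (show (0 : ℝ) ≤ q + 1 by positivity)
    calc (q : ℝ) * (q + 1) * Real.exp (-|y|) ≤ (q + 1) ^ 2 * Real.exp (-(q + 1 : ℝ)) := by
          gcongr; nlinarith
      _ ≤ 2 := h2
  calc NumberField.dedekindZeta_residue K * ‖(condQ q : ℂ) ^ (1 - z)‖ / ‖Complex.Gamma z‖ *
        ‖afeG (1 - z) / (1 - z) + afeG z / z‖
      = NumberField.dedekindZeta_residue K * ‖(condQ q : ℂ) ^ (1 - z)‖ * ‖Complex.Gamma z‖⁻¹ *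
          ‖afeG (1 - z) / (1 - z) + afeG z / z‖ := by rw [div_eq_mul_inv]
    _ ≤ (q * κ₀) * (q + 1) * (c⁻¹ * (|y| * Real.exp (Real.pi * |y| / 2))) *
          (2 * Real.exp (1 - y ^ 2)) := by
        gcongr
    _ = 2 * κ₀ / c * ((q : ℝ) * (q + 1)) *
          (|y| * Real.exp (Real.pi * |y| / 2) * Real.exp (1 - y ^ 2)) := by
        field_simp
    _ ≤ 2 * κ₀ / c * ((q : ℝ) * (q + 1)) * (Real.exp 1 * Real.exp (-|y|)) := by gcongr
    _ = 2 * Real.exp 1 * κ₀ / c * ((q : ℝ) * (q + 1) * Real.exp (-|y|)) := by ring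
    _ ≤ 2 * Real.exp 1 * κ₀ / c * 2 := by gcongr
    _ = 4 * Real.exp 1 * κ₀ / c := by ring

/-! ## §3. Cauchy's estimate and the divided differences -/

/-- **`|R′(w)| ≤ 4M` on the critical line at height `|Im w| ≥ q + 2`, `≥ 5`** (Cauchy's estimate
on the disc of radius `¼`). [cite: ConreyIwaniec2002, §8 (8.10)] -/
theorem norm_deriv_afeR_one_le :
    ∃ M : ℝ, 0 < M ∧ ∀ (q : ℕ), 0 < q → ∀ (K : Type) [Field K] [NumberField K],
      Module.finrank ℚ K = 2 → NumberField.discr K = -(q : ℤ) →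
        ∀ w : ℂ, w.re = 1 / 2 → (q : ℝ) + 2 ≤ |w.im| → 5 ≤ |w.im| →
          ‖deriv (afeR K 1 q) w‖ ≤ 4 * M := by
  obtain ⟨M, hM, hR⟩ := norm_afeR_one_le
  refine ⟨M, hM, fun q hq K _ _ h2 hdisc w hre hq2 h5 => ?_⟩
  have hq0 : (0 : ℝ) ≤ q := by positivity
  -- points of the closed disc of radius 1/4 stay off the real axis
  have hdisc_im : ∀ z : ℂ, ‖z - w‖ ≤ 1 / 4 → |w.im| - 1 / 4 ≤ |z.im| ∧ |z.re - w.re| ≤ 1 / 4 := by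
    intro z hz
    have h1 : |(z - w).im| ≤ ‖z - w‖ := Complex.abs_im_le_norm _
    have h2 : |(z - w).re| ≤ ‖z - w‖ := Complex.abs_re_le_norm _
    simp only [Complex.sub_im, Complex.sub_re] at h1 h2
    constructor
    · have := abs_sub_abs_le_abs_sub w.im z.im
      rw [abs_sub_comm] at this
      linarith
    · linarith
  have hdiff : DifferentiableOn ℂ (afeR K 1 q) (closure (Metric.ball w (1 / 4))) := by
    rw [closure_ball w (by norm_num)]
    intro z hz
    rw [Metric.mem_closedBall, dist_eq_norm] at hz
    have him : z.im ≠ 0 := by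
      have := (hdisc_im z hz).1
      intro h0; rw [h0, abs_zero] at this; linarith
    exact (differentiableAt_afeR_one K hq him).differentiableWithinAt
  have hC : ∀ z ∈ Metric.sphere w (1 / 4), ‖afeR K 1 q z‖ ≤ M := by
    intro z hz
    rw [Metric.mem_sphere, dist_eq_norm] at hz
    obtain ⟨him, hre'⟩ := hdisc_im z hz.le
    rw [hre] at hre'
    have hre1 : 1 / 4 ≤ z.re := by have := (abs_le.mp hre').1; linarith
    have hre2 : z.re ≤ 3 / 4 := by have := (abs_le.mp hre').2; linarith
    exact hR q hq K h2 hdisc z hre1 hre2 (by linarith) (by linarith)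
  have h := Complex.norm_deriv_le_of_forall_mem_sphere_norm_le (by norm_num : (0 : ℝ) < 1 / 4)
    hdiff.diffContOnCl hC
  linarith [h, show M / (1 / 4) = 4 * M by ring]

/-- **The divided differences of the residual are bounded**: for `s = ½+it`, `s′ = ½+it′`,
`t ≠ t′`, all heights between `t` and `t′` at least `q + 2` and `5`:
`|(R(s) − R(s′))/(s − s′)| ≤ 4M` (mean value theorem along the critical line).
[cite: ConreyIwaniec2002, §8 (8.10)] -/
theorem norm_dividedDiff_afeR_one_le :
    ∃ M : ℝ, 0 < M ∧ ∀ (q : ℕ), 0 < q → ∀ (K : Type) [Field K] [NumberField K],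
      Module.finrank ℚ K = 2 → NumberField.discr K = -(q : ℤ) →
        ∀ t t' : ℝ, t' ≠ t → (∀ u ∈ Set.uIcc t' t, (q : ℝ) + 2 ≤ u ∧ 5 ≤ u) →
          ‖(afeR K 1 q (1 / 2 + t * I) - afeR K 1 q (1 / 2 + t' * I)) / ((t : ℂ) * I - t' * I)‖ ≤
            4 * M := by
  obtain ⟨M, hM, hD⟩ := norm_deriv_afeR_one_le
  refine ⟨M, hM, fun q hq K _ _ h2 hdisc t t' htt' hu => ?_⟩
  set g : ℝ → ℂ := fun u => afeR K 1 q (1 / 2 + u * I) with hg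
  -- derivative of `g` along the line
  have hderiv : ∀ u ∈ Set.uIcc t' t, HasDerivAt g (deriv (afeR K 1 q) (1 / 2 + u * I) * I) u := by
    intro u huI
    obtain ⟨hq2, h5⟩ := hu u huI
    have him : ((1 / 2 : ℂ) + u * I).im ≠ 0 := by simp; linarith
    have h1 : HasDerivAt (fun z : ℂ => (1 / 2 : ℂ) + z * I) I (u : ℂ) := by
      simpa using ((hasDerivAt_id (u : ℂ)).mul_const I).const_add (1 / 2 : ℂ)
    have h2 : HasDerivAt (afeR K 1 q) (deriv (afeR K 1 q) (1 / 2 + u * I)) ((1 / 2 : ℂ) + u * I) :=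
      (differentiableAt_afeR_one K hq him).hasDerivAt
    have h3 := h2.comp (u : ℂ) h1
    exact h3.comp_ofReal
  have hdiffg : ∀ u ∈ Set.uIcc t' t, DifferentiableAt ℝ g u := fun u hu' => (hderiv u hu').differentiableAt
  have hbound : ∀ u ∈ Set.uIcc t' t, ‖deriv g u‖ ≤ 4 * M := by
    intro u hu'
    obtain ⟨hq2, h5⟩ := hu u hu'
    rw [(hderiv u hu').deriv, norm_mul, Complex.norm_I, mul_one]
    exact hD q hq K h2 hdisc _ (by simp) (by simp; rw [abs_of_nonneg (by linarith)]; linarith)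
      (by simp; rw [abs_of_nonneg (by linarith)]; linarith)
  have hmv := Convex.norm_image_sub_le_of_norm_deriv_le hdiffg hbound (convex_uIcc t' t)
    Set.left_mem_uIcc Set.right_mem_uIcc
  -- `‖g t − g t′‖ ≤ 4M |t − t′|`
  have hne : ((t : ℂ) * I - t' * I) ≠ 0 := by
    rw [← sub_mul]; refine mul_ne_zero ?_ I_ne_zero
    rw [sub_ne_zero]; exact fun h => htt' (by exact_mod_cast h.symm)
  have hnorm : ‖(t : ℂ) * I - t' * I‖ = ‖t - t'‖ := by
    rw [← sub_mul, norm_mul, Complex.norm_I, mul_one, show (t : ℂ) - t' = ((t - t' : ℝ) : ℂ) by push_cast; ring,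
      Complex.norm_real, Real.norm_eq_abs]
  rw [norm_div, div_le_iff₀ (norm_pos_iff.mpr hne), hnorm]
  simpa [hg] using hmv

/-! ## §4. The residual mean square (stub S6a) -/

/-- **CI §8: `Σ_{s ∈ S} |r(s)|² ≤ C·T`** for the divided differences
`r(s) = (R(s) − R(s′))/(s − s′)` of the residual term of Proposition 7.1 over a `1`-spaced
`S ⊂ (T, 2T]`, `T ≥ q^66`, companions `0 < |t′ − t| ≤ 1` — the registered stub S6a
`stub_residual_meanSquare` of the line `prop81-afe-plancherel` (`R = 0` unless `ψ = 1`).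
[cite: ConreyIwaniec2002, §8 (8.4)–(8.10), Proposition 7.1 (7.12)] -/
theorem residual_meanSquare_le :
    ∃ C : ℝ, 0 < C ∧
    ∀ (q : ℕ) [NeZero q], 4 < q →
      ∀ (K : Type) [Field K] [NumberField K],
        Module.finrank ℚ K = 2 → NumberField.discr K = -(q : ℤ) →
          ∀ (ψ : ClassGroup (𝓞 K) →* ℂˣ) (T : ℝ) (S : Finset ℝ) (t' : ℝ → ℝ),
            (q : ℝ) ^ (66 : ℕ) ≤ T → IsDyadicPointSet S T → (∀ t ∈ S, t' t ≠ t ∧ |t' t - t| ≤ 1) →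
              ∑ t ∈ S, ‖(afeR K ψ q (1 / 2 + t * I) - afeR K ψ q (1 / 2 + t' t * I)) /
                  ((t : ℂ) * I - t' t * I)‖ ^ 2 ≤ C * T := by
  classical
  obtain ⟨M, hM, hdd⟩ := norm_dividedDiff_afeR_one_le
  refine ⟨80 * M ^ 2, by positivity, ?_⟩
  intro q _ hq K _ _ h2 hdisc ψ T S t' hT hS ht'
  have hq0 : 0 < q := by omega
  have hq5 : (5 : ℝ) ≤ q := by exact_mod_cast hq
  -- `T ≥ q^66 ≥ q + 7`
  have hT7 : (q : ℝ) + 7 ≤ T := by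
    have h1 : (q : ℝ) ^ (66 : ℕ) = q * (q : ℝ) ^ (65 : ℕ) := by ring
    have h65 : (5 : ℝ) ≤ (q : ℝ) ^ (65 : ℕ) := by
      calc (5 : ℝ) ≤ q := hq5
        _ = (q : ℝ) ^ 1 := (pow_one _).symm
        _ ≤ (q : ℝ) ^ (65 : ℕ) := pow_le_pow_right₀ (by linarith) (by norm_num)
    nlinarith
  have hT2 : (2 : ℝ) ≤ T := by linarith
  -- the cardinality of `S`
  have hcard : (S.card : ℝ) ≤ 2 * (2 * T) + 2 :=
    ZetaM4D.card_le_of_sep S (by linarith) (fun t ht => by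
      obtain ⟨h1, h2⟩ := hS.1 t ht
      rw [abs_of_pos (by linarith)]; exact h2) hS.2
  -- pointwise bound
  have hpt : ∀ t ∈ S, ‖(afeR K ψ q (1 / 2 + t * I) - afeR K ψ q (1 / 2 + t' t * I)) /
      ((t : ℂ) * I - t' t * I)‖ ^ 2 ≤ (4 * M) ^ 2 := by
    intro t ht
    apply pow_le_pow_left₀ (norm_nonneg _)
    by_cases hψ : ψ = 1
    · subst hψ
      obtain ⟨hTt, -⟩ := hS.1 t ht
      refine hdd q hq0 K h2 hdisc t (t' t) (ht' t ht).1 fun u hu => ?_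
      have hu1 : t - 1 ≤ u := by
        rcases Set.mem_uIcc.mp hu with ⟨h1, -⟩ | ⟨h1, -⟩
        · have := (abs_le.mp (ht' t ht).2).1; linarith
        · linarith
      constructor <;> linarith
    · simp [afeR_of_ne_one hψ]
      positivity
  calc ∑ t ∈ S, ‖(afeR K ψ q (1 / 2 + t * I) - afeR K ψ q (1 / 2 + t' t * I)) /
        ((t : ℂ) * I - t' t * I)‖ ^ 2
      ≤ ∑ t ∈ S, (4 * M) ^ 2 := Finset.sum_le_sum hpt
    _ = S.card * (4 * M) ^ 2 := by rw [Finset.sum_const, nsmul_eq_mul]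
    _ ≤ (2 * (2 * T) + 2) * (4 * M) ^ 2 := by gcongr
    _ ≤ (5 * T) * (4 * M) ^ 2 := by gcongr; linarith
    _ = 80 * M ^ 2 * T := by ring

end ConreyIwaniec2002

end Literature.NumberTheory.LFunctions
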